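import Summits.Ventures.DiscreteObjects.PP12.FlagSevenColOrbits
import Summits.Ventures.DiscreteObjects.PP12.FlagSevenRowOrbits

/-!
# The `f = 7` flag-cell orbit matrix: the entries as incidence counts, II — the side rows (kernel; Step C₂ of the FlagSevenOrbitReduction roadmap)
Framing: lottery ticket; floor = certified bounds/negative ranges.

Cell pub-namedobj (venture DiscreteObjects), target (M), designs gen 14. Companion of `FlagSevenEntriesA`: for the side row `(s,i)` (representative
line `sideOf x_{s,i}`) the entries of `IsFlagSevenOrbitMatrix` (p327216) are the incidence counts of the plane:
* `entry_eq_side_z` — against `Z_t`: `[κ s i = t]` (the side meets `l` in one point, in the orbit `κ`);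
* `entry_eq_side_tpt` — against the T-point orbit `(j,t)`: `[γ s i j = t]`;
* `entry_eq_side_tri` — against the triangle `(s',i')`: `2[i'=i] + [i' = ψ s i]` for the same class (own vertices `x, σx`; the odd point
  `sideOf x ∩ σ²(cl s)` belongs to the triangle `ψ s i`; no other vertex of class `s`, since the side meets `cl s, σ(cl s), σ²(cl s)` once each),
  `[i' ∈ R s i]` for the other class (at most one vertex: two would make the side a side of that triangle, `side_unique`).
With part I, `entry r c = |colOrbit c ∩ lineRep r|` for ALL rows and columns (`FlagSevenOrbitReduction.entry_eq_card`). No `sorry`, no new axioms.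
-/

namespace Summit.Ventures.DiscreteObjects.PP12

open Configuration Finset
open scoped Classical

namespace Collineation

variable {P L : Type*} [Membership P L] [ProjectivePlane P L] [Fintype P] [Fintype L] (σ : Collineation P L)

section Flag

variable {l : L} {c : P} (hl : σ.onLines l = l) (hc : σ.onPoints c = c) (hcl : c ∈ l)
  (hP : ∀ p : P, σ.onPoints p = p → p ∈ l) (hL : ∀ m : L, σ.onLines m = m → c ∈ m)
  (h12 : ProjectivePlane.order P L = 12)

section Data

variable (hl : σ.onLines l = l) (hc : σ.onPoints c = c) (hcl : c ∈ l)
  (hP : ∀ p : P, σ.onPoints p = p → p ∈ l) (hL : ∀ m : L, σ.onLines m = m → c ∈ m) (h12 : ProjectivePlane.order P L = 12)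
  (hq : σ.onPoints ^ 3 = 1) (hf : fixedCard σ.onPoints = 7) {u₀ u₁ : L} (hcu₀ : c ∈ u₀) (hu₀ : σ.onLines u₀ ≠ u₀)
  (hcu₁ : c ∈ u₁) (hu₁ : σ.onLines u₁ ≠ u₁)

/-- `entry (side (s,i)) (Z_t) = [κ s i = t]`. -/
theorem entry_eq_side_z (s : Fin 2) (i : Fin 12) (t : Fin 2) :
    (σ.flagSevenDataOfPlane hl hc hcl hP hL h12 hq hf hcu₀ hu₀ hcu₁ hu₁).entry (Sum.inr (Sum.inl (s, i))) (Sum.inl t)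
      = ((σ.colOrbit hl hc hcl hP hL h12 hq hf hcu₀ hu₀ hcu₁ hu₁ (Sum.inl t)).filter
          fun q => q ∈ σ.lineRep hl hc hcl hP hL h12 hq hf hcu₀ hu₀ hcu₁ hu₁ (Sum.inr (Sum.inl (s, i)))).card := by
  set x := σ.eTri7 h12 hcu₀ hu₀ hcu₁ hu₁ s i with hx
  set eZ' := σ.eZ hl hP h12 hq hf with heZ
  obtain ⟨z, hz, hzeq⟩ := mem_image.1 (eZ' t).2
  rw [mem_filter] at hz
  have hxX := σ.exterior_of_triIdx s x hcu₀ hu₀ hcu₁ hu₁ hL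
  have hxf : σ.onPoints x.1 ≠ x.1 := σ.not_fixed_of_exterior_flag hl hP hxX
  obtain ⟨hxa, hσxa⟩ := σ.sideOf_spec l hxf
  obtain ⟨-, ha0⟩ := σ.side_no_fixed_point hxf hxX hxa hσxa
  have hal : σ.sideOf l x.1 ≠ l := fun e => ha0 c hc (by rw [e]; exact hcl)
  have hκ : (σ.flagSevenDataOfPlane hl hc hcl hP hL h12 hq hf hcu₀ hu₀ hcu₁ hu₁).κ s i = eZ'.symm
      ⟨orb3 σ.onPoints (meetPt c (σ.sideOf l x.1) l), σ.sideZ_mem hl hc hcl hP hxX⟩ := rfl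
  change FlagSevenOrbitData.ind ((σ.flagSevenDataOfPlane hl hc hcl hP hL h12 hq hf hcu₀ hu₀ hcu₁ hu₁).κ s i = t)
    = (((eZ' t).1 : Finset P).filter fun q => q ∈ σ.sideOf l x.1).card
  rw [← hzeq, σ.card_filter_orb3_on_fixedLine (c := c) hl hal hz.2.1]
  have hiff : (σ.flagSevenDataOfPlane hl hc hcl hP hL h12 hq hf hcu₀ hu₀ hcu₁ hu₁).κ s i = t ↔
      meetPt c (σ.sideOf l x.1) l ∈ orb3 σ.onPoints z := by
    rw [hκ]
    constructor
    · intro h1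
      have := congrArg (fun s => (eZ' s).1) h1
      simp only [Equiv.apply_symm_apply] at this
      rw [← hzeq] at this
      rw [← this]; exact self_mem_orb3 _ _
    · intro h1
      apply eZ'.injective; rw [Equiv.apply_symm_apply]; apply Subtype.ext
      change orb3 σ.onPoints (meetPt c (σ.sideOf l x.1) l) = (eZ' t).1
      rw [← hzeq]; exact orb3_eq_of_mem σ.onPoints hq h1
  unfold FlagSevenOrbitData.ind
  by_cases h : meetPt c (σ.sideOf l x.1) l ∈ orb3 σ.onPoints z
  · rw [if_pos h, if_pos (hiff.2 h)]
  · rw [if_neg h, if_neg (fun h' => h (hiff.1 h'))]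

/-- `entry (side (s,i)) (T-point orbit (j,t)) = [γ s i j = t]`. -/
theorem entry_eq_side_tpt (s : Fin 2) (i : Fin 12) (j : Fin 6) (t : Fin 4) :
    (σ.flagSevenDataOfPlane hl hc hcl hP hL h12 hq hf hcu₀ hu₀ hcu₁ hu₁).entry (Sum.inr (Sum.inl (s, i))) (Sum.inr (Sum.inr (j, t)))
      = ((σ.colOrbit hl hc hcl hP hL h12 hq hf hcu₀ hu₀ hcu₁ hu₁ (Sum.inr (Sum.inr (j, t)))).filter
          fun q => q ∈ σ.lineRep hl hc hcl hP hL h12 hq hf hcu₀ hu₀ hcu₁ hu₁ (Sum.inr (Sum.inl (s, i)))).card := by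
  set x := σ.eTri7 h12 hcu₀ hu₀ hcu₁ hu₁ s i with hx
  set m := σ.eFixL6 hl hc hf j with hm
  set eO := σ.eOrbOn hc hcl hP hL h12 hq m with heO
  obtain ⟨w, hw, hweq⟩ := mem_image.1 (eO t).2
  rw [mem_filter] at hw
  have hxX := σ.exterior_of_triIdx s x hcu₀ hu₀ hcu₁ hu₁ hL
  have hxf : σ.onPoints x.1 ≠ x.1 := σ.not_fixed_of_exterior_flag hl hP hxX
  obtain ⟨hxa, hσxa⟩ := σ.sideOf_spec l hxf
  obtain ⟨-, ha0⟩ := σ.side_no_fixed_point hxf hxX hxa hσxa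
  have ham : σ.sideOf l x.1 ≠ m.1 := fun e => ha0 c hc (by rw [e]; exact hL m.1 m.2.1)
  have hγ : (σ.flagSevenDataOfPlane hl hc hcl hP hL h12 hq hf hcu₀ hu₀ hcu₁ hu₁).γ s i j = eO.symm
      ⟨σ.gammaOrb l c m.1 x.1, (σ.gammaOrb_mem hl hc hP hL hxX m.2.1).1⟩ := rfl
  change FlagSevenOrbitData.ind ((σ.flagSevenDataOfPlane hl hc hcl hP hL h12 hq hf hcu₀ hu₀ hcu₁ hu₁).γ s i j = t)
    = (((eO t).1 : Finset P).filter fun q => q ∈ σ.sideOf l x.1).card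
  rw [← hweq, σ.card_filter_orb3_on_fixedLine (c := c) m.2.1 ham hw.2.1]
  have hiff : (σ.flagSevenDataOfPlane hl hc hcl hP hL h12 hq hf hcu₀ hu₀ hcu₁ hu₁).γ s i j = t ↔
      meetPt c (σ.sideOf l x.1) m.1 ∈ orb3 σ.onPoints w := by
    rw [hγ]
    constructor
    · intro h1
      have := congrArg (fun s => (eO s).1) h1
      simp only [Equiv.apply_symm_apply] at this
      rw [← hweq] at this
      change orb3 σ.onPoints (meetPt c (σ.sideOf l x.1) m.1) = orb3 σ.onPoints w at this
      rw [← this]; exact self_mem_orb3 _ _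
    · intro h1
      apply eO.injective; rw [Equiv.apply_symm_apply]; apply Subtype.ext
      change orb3 σ.onPoints (meetPt c (σ.sideOf l x.1) m.1) = (eO t).1
      rw [← hweq]; exact orb3_eq_of_mem σ.onPoints hq h1
  unfold FlagSevenOrbitData.ind
  by_cases h : meetPt c (σ.sideOf l x.1) m.1 ∈ orb3 σ.onPoints w
  · rw [if_pos h, if_pos (hiff.2 h)]
  · rw [if_neg h, if_neg (fun h' => h (hiff.1 h'))]

/-- `entry (side (s,i)) (triangle (s',i'))`: `2[i'=i] + [i' = ψ s i]` for `s' = s`, `[i' ∈ R s i]` otherwise. -/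
theorem entry_eq_side_tri (h01 : u₁ ∉ orb3 σ.onLines u₀) (s : Fin 2) (i : Fin 12) (s' : Fin 2) (i' : Fin 12) :
    (σ.flagSevenDataOfPlane hl hc hcl hP hL h12 hq hf hcu₀ hu₀ hcu₁ hu₁).entry (Sum.inr (Sum.inl (s, i))) (Sum.inr (Sum.inl (s', i')))
      = ((σ.colOrbit hl hc hcl hP hL h12 hq hf hcu₀ hu₀ hcu₁ hu₁ (Sum.inr (Sum.inl (s', i')))).filter
          fun q => q ∈ σ.lineRep hl hc hcl hP hL h12 hq hf hcu₀ hu₀ hcu₁ hu₁ (Sum.inr (Sum.inl (s, i)))).card := by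
  have hqL : σ.onLines ^ 3 = 1 := σ.onLines_pow_eq_one hq
  have h3 := apply_three σ.onPoints hq
  set D := σ.flagSevenDataOfPlane hl hc hcl hP hL h12 hq hf hcu₀ hu₀ hcu₁ hu₁ with hD
  set e := σ.eTri7 h12 hcu₀ hu₀ hcu₁ hu₁ s with he
  set x := e i with hx
  have hcs := σ.cl_spec hcu₀ hu₀ hcu₁ hu₁ s
  have hxX := σ.exterior_of_triIdx s x hcu₀ hu₀ hcu₁ hu₁ hL
  have hxf : σ.onPoints x.1 ≠ x.1 := σ.not_fixed_of_exterior_flag hl hP hxX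
  obtain ⟨hxa, hσxa⟩ := σ.sideOf_spec l hxf
  obtain ⟨hna, ha0⟩ := σ.side_no_fixed_point hxf hxX hxa hσxa
  change D.entry (Sum.inr (Sum.inl (s, i))) (Sum.inr (Sum.inl (s', i')))
    = ((orb3 σ.onPoints (σ.eTri7 h12 hcu₀ hu₀ hcu₁ hu₁ s' i').1).filter fun q => q ∈ σ.sideOf l x.1).card
  have hentry : D.entry (Sum.inr (Sum.inl (s, i))) (Sum.inr (Sum.inl (s', i')))
      = if s' = s then 2 * FlagSevenOrbitData.ind (i' = i) + FlagSevenOrbitData.ind (i' = D.ψ s i)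
        else FlagSevenOrbitData.ind (i' ∈ D.R s i) := rfl
  rw [hentry]
  by_cases hss : s' = s
  · subst hss
    rw [if_pos rfl]
    set x' := e i' with hx'
    change _ = ((orb3 σ.onPoints x'.1).filter fun q => q ∈ σ.sideOf l x.1).card
    by_cases hii : i' = i
    · subst hii
      change _ = ((orb3 σ.onPoints x.1).filter fun q => q ∈ σ.sideOf l x.1).card
      unfold FlagSevenOrbitData.ind
      rw [if_pos rfl, if_neg (fun h => (σ.flagSevenDataOfPlane_psi_ne hl hc hcl hP hL h12 hq hf hcu₀ hu₀ hcu₁ hu₁ s' i') h.symm),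
        σ.filter_orb3_eq_pair_of_side hxf hna hxa hσxa, card_pair (fun e0 => hxf e0.symm)]
    · -- i' ≠ i: at most one vertex of the triangle of x' on the side, and one iff x' is the odd vertex
      have hx'X := σ.exterior_of_triIdx s' x' hcu₀ hu₀ hcu₁ hu₁ hL
      have hne : x'.1 ≠ x.1 := fun e0 => hii (e.injective (Subtype.ext e0))
      have hx'nx : x'.1 ∉ orb3 σ.onPoints x.1 := fun h' => hne (σ.vertex_eq_of_mem_orb3 hc hq hcs.1 hcs.2 x'.2.1 x.2.1 h')
      have hle : ((orb3 σ.onPoints x'.1).filter fun q => q ∈ σ.sideOf l x.1).card ≤ 1 := by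
        by_contra hlt
        have two : 2 ≤ ((orb3 σ.onPoints x'.1).filter fun q => q ∈ σ.sideOf l x.1).card := by omega
        have twox : 2 ≤ ((orb3 σ.onPoints x.1).filter fun q => q ∈ σ.sideOf l x.1).card := by
          rw [σ.filter_orb3_eq_pair_of_side hxf hna hxa hσxa, card_pair (fun e0 => hxf e0.symm)]
        have heq := σ.orb3_eq_of_two_le hq hna two twox
        exact hx'nx (by rw [← heq]; exact self_mem_orb3 _ _)
      -- the odd point o = side ∩ σ²(cl s) and the odd vertex σ o
      have hcσ : ∀ v : L, c ∈ v → c ∈ σ.onLines v := fun v hv => by have := σ.mem_map hv; rwa [hc] at this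
      have h3L := apply_three σ.onLines hqL (cl u₀ u₁ s')
      have hcu2 : c ∈ σ.onLines (σ.onLines (cl u₀ u₁ s')) := hcσ _ (hcσ _ hcs.1)
      have hau2 : σ.sideOf l x.1 ≠ σ.onLines (σ.onLines (cl u₀ u₁ s')) := fun e0 => ha0 c hc (by rw [e0]; exact hcu2)
      obtain ⟨hoa, hou2⟩ := meetPt_spec c hau2
      have hψ : D.ψ s' i = e.symm ⟨σ.oddVertex l c (cl u₀ u₁ s') x.1,
          (σ.oddVertex_spec hl hc hP hL hq hcs.1 hcs.2 x.2.1 x.2.2).1, (σ.oddVertex_spec hl hc hP hL hq hcs.1 hcs.2 x.2.1 x.2.2).2.1⟩ := rfl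
      have hiffψ : i' = D.ψ s' i ↔ x'.1 = σ.oddVertex l c (cl u₀ u₁ s') x.1 := by
        rw [hψ]
        constructor
        · intro h1
          have := congrArg (fun i₀ => (e i₀).1) h1
          simp only [Equiv.apply_symm_apply] at this
          rw [← hx'] at this; exact this
        · intro h1
          apply e.injective; rw [Equiv.apply_symm_apply]; apply Subtype.ext; rw [← hx']; exact h1
      -- `x'.1 = σ o` iff some vertex of the triangle of x' lies on the side
      have hiff : x'.1 = σ.oddVertex l c (cl u₀ u₁ s') x.1 ↔ ∃ q ∈ orb3 σ.onPoints x'.1, q ∈ σ.sideOf l x.1 := by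
        unfold oddVertex
        constructor
        · intro h1
          -- σ² x' = o lies on the side
          refine ⟨σ.onPoints (σ.onPoints x'.1), (mem_orb3 _ _ _).2 (Or.inr (Or.inr rfl)), ?_⟩
          rw [h1, h3]; exact hoa
        · rintro ⟨q, hq', hqa⟩
          -- q lies on σ^k (cl s') and on the side; the side meets cl s', σ cl s', σ² cl s' in x, σx, o
          have hau0 : σ.sideOf l x.1 ≠ cl u₀ u₁ s' := fun e0 => ha0 c hc (by rw [e0]; exact hcs.1)
          have hau1 : σ.sideOf l x.1 ≠ σ.onLines (cl u₀ u₁ s') := fun e0 => ha0 c hc (by rw [e0]; exact hcσ _ hcs.1)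
          rw [mem_orb3] at hq'
          rcases hq' with e0 | e0 | e0
          · -- q = x' ∈ cl s' ∩ side = {x}
            exfalso
            rw [e0] at hqa
            have : x'.1 = x.1 := (Nondegenerate.eq_or_eq hqa hxa x'.2.1 x.2.1).resolve_right hau0
            exact hne this
          · -- q = σ x' ∈ σ(cl s') ∩ side = {σ x}
            exfalso
            rw [e0] at hqa
            have : σ.onPoints x'.1 = σ.onPoints x.1 :=
              (Nondegenerate.eq_or_eq hqa hσxa (σ.mem_map x'.2.1) (σ.mem_map x.2.1)).resolve_right hau1
            exact hne (σ.onPoints.injective this)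
          · -- q = σ² x' ∈ σ²(cl s') ∩ side = {o}
            rw [e0] at hqa
            have : σ.onPoints (σ.onPoints x'.1) = meetPt c (σ.sideOf l x.1) (σ.onLines (σ.onLines (cl u₀ u₁ s'))) :=
              (Nondegenerate.eq_or_eq hqa hoa (σ.mem_map (σ.mem_map x'.2.1)) hou2).resolve_right hau2
            rw [← this, h3]
      unfold FlagSevenOrbitData.ind
      rw [if_neg hii, mul_zero, zero_add]
      by_cases h : ∃ q ∈ orb3 σ.onPoints x'.1, q ∈ σ.sideOf l x.1
      · rw [if_pos (hiffψ.2 (hiff.2 h))]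
        obtain ⟨q, hq', hqa⟩ := h
        have hpos : 0 < ((orb3 σ.onPoints x'.1).filter fun q => q ∈ σ.sideOf l x.1).card := card_pos.2 ⟨q, mem_filter.2 ⟨hq', hqa⟩⟩
        omega
      · rw [if_neg (fun h' => h (hiff.1 (hiffψ.1 h'))), eq_comm, card_eq_zero, filter_eq_empty_iff]
        intro q hq' hqa
        exact h ⟨q, hq', hqa⟩
  · -- other class: at most one vertex on the side, one iff i' ∈ R s i
    rw [if_neg hss]
    have hss' : s' = 1 - s := by
      have key : ∀ a b : Fin 2, b ≠ a → b = 1 - a := by decide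
      exact key s s' hss
    subst hss'
    set x' := σ.eTri7 h12 hcu₀ hu₀ hcu₁ hu₁ (1 - s) i' with hx'
    have hR : D.R s i = univ.filter fun i₀ : Fin 12 =>
        ∃ q ∈ orb3 σ.onPoints (σ.eTri7 h12 hcu₀ hu₀ hcu₁ hu₁ (1 - s) i₀).1, q ∈ σ.sideOf l x.1 := rfl
    rw [hR, mem_filter]
    have hle : ((orb3 σ.onPoints x'.1).filter fun q => q ∈ σ.sideOf l x.1).card ≤ 1 := by
      by_contra hlt
      obtain ⟨Q, hQx', -, hQa, hσQa⟩ := σ.exists_consecutive_of_two_le hq (a := σ.sideOf l x.1) (q := x'.1) (by omega)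
      have hQx : Q = x.1 := σ.side_unique hxX hxa hσxa hQa hσQa
      rw [hQx] at hQx'
      exact σ.triIdx_class_unique hc hq hcu₀ hu₀ hcu₁ h01 (fun e0 => hss e0.symm) x' hQx' x.2.1 x.2.2
    unfold FlagSevenOrbitData.ind
    by_cases h : ∃ q ∈ orb3 σ.onPoints x'.1, q ∈ σ.sideOf l x.1
    · rw [if_pos ⟨mem_univ _, h⟩]
      obtain ⟨q, hq', hqa⟩ := h
      have hpos : 0 < ((orb3 σ.onPoints x'.1).filter fun q => q ∈ σ.sideOf l x.1).card := card_pos.2 ⟨q, mem_filter.2 ⟨hq', hqa⟩⟩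
      omega
    · rw [if_neg (fun h' => h h'.2), eq_comm, card_eq_zero, filter_eq_empty_iff]
      intro q hq' hqa
      exact h ⟨q, hq', hqa⟩

end Data

end Flag

end Collineation

end Summit.Ventures.DiscreteObjects.PP12
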